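import Summits.AtomisticToContinuum.Crystallization.Theorems.OverbindingBudgetAffineFarFieldLedgerShells
import Summits.AtomisticToContinuum.Crystallization.Theorems.OverbindingBudgetAffineFarFieldLedgerTiling

/-!
# Overbinding budget, affine far field — «LedgerFinal»: the far-field ledger OF A WINDOW

Support file for `Summit.AtomisticToContinuum.Crystallization.Theses.OverbindingBudget.RobustDefectLimitWindows`
(sub-problem (2c), leaf SW♭(30), part 27V «Voronoi-cell quadrature of the far field», design (R*), instance 27Vc).
The thin COMPOSITION of the density + ledger side: «LedgerShells» `farField_ledger_of_shells` (the ledger with the per-mover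
rows read off the two coordination shells) ∘ «LedgerTiling» `tiling_window` (its eight tessellation hypotheses discharged with
`Wr := univ`, `Uc₁ := moverRest … t`, `Uc₂ := refRest … uref`) ∘ «LedgerTiling» `halo_zero_act` / `halo_zero_ref` (the halo
cells carry no `g`, so the seam term is `√2/ν³·(∫_{collarRefCore} g − ∫_{collarActCore} g)`) ∘ an INTERFACE BUDGET
`|∫_{collarActCore} g − ∫_{collarRefCore} g| ≤ Bint` taken as a hypothesis IN THE EXACT SHAPE of the conclusion of «CollarNear»
`interfaceRow_rows` / «CollarWindow» `interfaceRow_window` (so the window file writes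
`farField_ledger_window … (interfaceRow_rows …)`).

CONCLUSION: `|Σ_movers (g + ν²/32·Δg)(ych i) − Σ_uref (g + ν²/32·Δg)(p j) − Σ_movers (|K_i|⁻¹ − √2/ν³)·∫_{K_i} g|
≤ (the «LedgerWindow» Taylor budget, verbatim) + √2/ν³ · Bint`.

HYPOTHESES = those of `farField_ledger_of_shells` with the tessellation block REPLACED by window rows: `μ` finite, `Ach` finite
and non-empty, `ych` injective on `Ach`, movers `t ⊆ Ach ∖ core` with atoms off the uncharted ones, `uref ∩ core = ∅`,
`Integrable g`, (H-supp) `supp g ⊆ closedBall q₀ ρg`, (H-ann) the annulus `ρ₁ < dist (p u) q₀ ≤ ρg + r₀` is charted, (H-near)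
an atom `z₀` within `R₀` of `q₀`, (H-halo) `ρg + r₀ + û < dist (ych u) q₀` and `2(ρ₁ + r₀) + R₀ < dist (ych u) q₀` for charted
non-core sites off `t`, `ρg + r₀ < dist (p u) q₀` for non-core sites off `uref`, and the interface budget `hint`.
Row map: memo TILING-g98.md §2–§3 (halo), SHELLS-g98.md §2 (shells), LEDGERROWS-g98.md (chart rows).  No local notation.

[this file]
-/

namespace Summit.AtomisticToContinuum.Crystallization.Theorems.OverbindingBudgetAffineFarFieldLedgerFinal

noncomputable section

open Set MeasureTheory Metric
open Literature.Geometry.DiscreteGeometry Literature.MathematicalPhysics.StatisticalMechanics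
open Literature.Barriers.AtomisticToContinuum (voronoiCell)
open Summit.AtomisticToContinuum.Crystallization.Theorems.OverbindingBudgetAffineFarFieldCellTaylor
open Summit.AtomisticToContinuum.Crystallization.Theorems.OverbindingBudgetAffineFarFieldCellRD
open Summit.AtomisticToContinuum.Crystallization.Theorems.OverbindingBudgetAffineFarFieldCellTRD
open Summit.AtomisticToContinuum.Crystallization.Theorems.OverbindingBudgetAffineFarFieldCellLedgerIdeal
open Summit.AtomisticToContinuum.Crystallization.Theorems.OverbindingBudgetAffineFarFieldCellLattice
open Summit.AtomisticToContinuum.Crystallization.Theorems.OverbindingBudgetAffineFarFieldCollarSites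
open Summit.AtomisticToContinuum.Crystallization.Theorems.OverbindingBudgetAffineFarFieldCollarWindow
open Summit.AtomisticToContinuum.Crystallization.Theorems.OverbindingBudgetAffineFarFieldLedgerShells
open Summit.AtomisticToContinuum.Crystallization.Theorems.OverbindingBudgetAffineFarFieldLedgerTiling

/-- support (TRIANGLE STEP FOR THE SEAM): `|X − c·Y| ≤ r`, `|Y| ≤ b`, `0 ≤ c` ⇒ `|X| ≤ r + c·b`. [Mathlib] -/
theorem abs_le_budget_of_seam {X Y r b c : ℝ} (hc : 0 ≤ c) (h : |X - c * Y| ≤ r) (hY : |Y| ≤ b) : |X| ≤ r + c * b := by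
  have h1 := abs_sub_abs_le_abs_sub X (c * Y)
  rw [abs_mul, abs_of_nonneg hc] at h1
  nlinarith [mul_le_mul_of_nonneg_left hY hc]

/-- ★★★ support (THE FAR-FIELD LEDGER OF A WINDOW): «LedgerShells» `farField_ledger_of_shells` with its eight tessellation
hypotheses DISCHARGED by «LedgerTiling» `tiling_window` (`Wr := univ`, `Uc₁ := moverRest … t`, `Uc₂ := refRest … uref`), the seam
`√2/ν³·(∫_{Uc₂} g − ∫_{Uc₁} g)` identified with the interface term by `halo_zero_act`/`halo_zero_ref` and bounded by the interface
budget `hint` (conclusion shape of «CollarNear» `interfaceRow_rows`); every other hypothesis and the Taylor budget verbatim.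
[this file: «LedgerShells» + «LedgerTiling»] -/
theorem farField_ledger_window (hC : HasRadialMoments (rdCell 1) 16 24 (656 / 15))
    (hT : |∫ x in trdCell 1, x 0 * x 1 * x 2| ≤ 112 / 405)
    {μ : Type*} [Finite μ] {s : ℤ → ℤ} (hs : IsHaggSeq s) {ν : ℝ} (hν : 0 < ν) (q : EuclideanSpace ℝ (Fin 3))
    (R : EuclideanSpace ℝ (Fin 3) ≃ₗᵢ[ℝ] EuclideanSpace ℝ (Fin 3)) {Ach : Set (ℤ × ℤ × ℤ)}
    (hAfin : Ach.Finite) (hAne : Ach.Nonempty) {ych : ℤ × ℤ × ℤ → EuclideanSpace ℝ (Fin 3)} (hinj : InjOn ych Ach)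
    (yunc : μ → EuclideanSpace ℝ (Fin 3)) {r₀ û : ℝ}
    (hr₀ : r₀ = ν / Real.sqrt 2) (hû : 2 * û < ν) (hreg : ∀ u ∈ Ach, dist (ych u) (placedSite s ν q R u) ≤ û)
    (q₀ : EuclideanSpace ℝ (Fin 3)) {ρ₀ : ℝ} (hunc : ∀ e, dist (yunc e) q₀ ≤ ρ₀)
    -- the window: core radius, movers = charted non-core sites off the uncharted atoms, reference sites off the core
    {r_c : ℝ} (t uref : Finset (ℤ × ℤ × ℤ)) (ht : ∀ u ∈ t, u ∈ Ach ∧ u ∉ collarCoreSites s ν q R q₀ r_c)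
    (hsep : ∀ u ∈ t, ∀ e, ych u ≠ yunc e) (huref : ∀ j ∈ uref, j ∉ collarCoreSites s ν q R q₀ r_c)
    {A : ℤ × ℤ × ℤ → (EuclideanSpace ℝ (Fin 3) ≃L[ℝ] EuclideanSpace ℝ (Fin 3))} {lam av alow ρQ : ℤ × ℤ × ℤ → ℝ}
    {θ m a δ₀ δ₂ σ θv lmin r₁ : ℝ}
    (hθ0 : 0 ≤ θ) (hm0 : 0 ≤ m) (hm1 : m ≤ 1) (hσ0 : 0 ≤ σ) (hσ1 : σ < 1) (hθv0 : 0 ≤ θv)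
    (hθv : (1 + σ) ^ 3 ≤ (1 + θv) * (1 - σ) ^ 3) (hδ₀ : 0 ≤ δ₀)
    -- the chart rows, per mover (verbatim)
    (hθ : ∀ u ∈ t, ∀ x, ‖A u x - x‖ ≤ θ * ‖x‖)
    (hB : ∀ u ∈ t, ∀ x x' : EuclideanSpace ℝ (Fin 3),
      |inner ℝ (A u x) (A u x') - lam u ^ 2 * inner ℝ x x'| ≤ m * lam u ^ 2 * ‖x‖ * ‖x'‖)
    (ha : ∀ u ∈ t, ‖(A u : EuclideanSpace ℝ (Fin 3) →L[ℝ] EuclideanSpace ℝ (Fin 3))‖ ≤ av u) (hav : ∀ u ∈ t, av u ≤ a)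
    -- the shell data, per mover
    (hch : ∀ u ∈ t, ∀ u', barlowSiteForm s u u' ≤ 24 → u' ∈ Ach)
    (hres1 : ∀ u ∈ t, ∀ u', barlowSiteForm s u u' = 12 →
      dist (ych u') (ych u + A u (placedSite s ν q R u' - placedSite s ν q R u)) ≤ δ₀)
    (hres2 : ∀ u ∈ t, ∀ u', barlowSiteForm s u u' = 24 →
      dist (ych u') (ych u + A u (placedSite s ν q R u' - placedSite s ν q R u)) ≤ δ₂)
    (hfar : ∀ u ∈ t, ρ₀ + ρQ u + û ≤ dist (placedSite s ν q R u) q₀)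
    (hρQ : ∀ u ∈ t, 0 ≤ ρQ u ∧ 2 * (av u * (1 - σ)) ^ 2 * ν ^ 2 ≤ ρQ u ^ 2)
    (hal : ∀ u ∈ t, 0 ≤ alow u ∧ alow u ^ 2 ≤ (1 - m) * lam u ^ 2)
    (hsh2 : ∀ u ∈ t, (ρQ u + δ₂) ^ 2 ≤ 2 * ν ^ 2 * alow u ^ 2) (hsh3 : ∀ u ∈ t, 3 * (ρQ u + 2 * û) ^ 2 ≤ 8 * ν ^ 2)
    -- the sandwich rows, once
    (hlmin : 0 < lmin) (hl : ∀ u ∈ t, lmin ≤ lam u) (hr₁ : 0 ≤ r₁) (hr₁' : ν ^ 2 ≤ 2 * r₁ ^ 2)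
    (hin0 : (1 - σ) * m * lmin ^ 2 * ν ^ 2 / 2 + a * δ₀ * ((1 - σ) * r₁ + ν) ≤ σ * (1 - m) * lmin ^ 2 * ν ^ 2 / 2)
    (hout0 : (1 + σ) * m * lmin ^ 2 * ν ^ 2 / 2 + a * δ₀ * ((1 + σ) * r₁ + ν) + δ₀ ^ 2 / 2 <
      σ * (1 - m) * lmin ^ 2 * ν ^ 2 / 2)
    -- the window: kernel support radius, charted annulus, one near atom, halo rows, interface budget
    {U : Set (EuclideanSpace ℝ (Fin 3))} {g : EuclideanSpace ℝ (Fin 3) → ℝ} {D₁ D₂ D₃ D₄ E₃ E₄ : ℤ × ℤ × ℤ → ℝ}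
    (hgi : Integrable g) {ρ₁ ρg R₀ Bint : ℝ} (hsupp : ∀ x, g x ≠ 0 → dist x q₀ ≤ ρg)
    (hchA : ∀ u, ρ₁ < dist (placedSite s ν q R u) q₀ → dist (placedSite s ν q R u) q₀ ≤ ρg + r₀ → u ∈ Ach)
    {z₀ : EuclideanSpace ℝ (Fin 3)} (hz₀ : z₀ ∈ windowAtomSet Ach ych yunc) (hR₀ : dist z₀ q₀ ≤ R₀)
    (hh1 : ∀ u ∈ Ach, u ∉ collarCoreSites s ν q R q₀ r_c → u ∉ t → ρg + r₀ + û < dist (ych u) q₀)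
    (hh2 : ∀ u ∈ Ach, u ∉ collarCoreSites s ν q R q₀ r_c → u ∉ t → 2 * (ρ₁ + r₀) + R₀ < dist (ych u) q₀)
    (hh : ∀ u, u ∉ collarCoreSites s ν q R q₀ r_c → u ∉ uref → ρg + r₀ < dist (placedSite s ν q R u) q₀)
    (hint : |(∫ x in collarActCore s ν q R Ach ych yunc q₀ r_c, g x) - ∫ x in collarRefCore s ν q R q₀ r_c, g x| ≤ Bint)
    -- the kernel (verbatim)
    (hU : IsOpen U) (hKU : ∀ i ∈ t, voronoiCell (windowAtomSet Ach ych yunc) (ych i) ⊆ U)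
    (hKrU : ∀ j ∈ uref, refCell s ν q R j ⊆ U) (hg : ContDiffOn ℝ 4 g U)
    (h1 : ∀ i ∈ t, ‖fderiv ℝ g (ych i)‖ ≤ D₁ i) (h2 : ∀ i ∈ t, ‖iteratedFDeriv ℝ 2 g (ych i)‖ ≤ D₂ i)
    (h3 : ∀ i ∈ t, ‖iteratedFDeriv ℝ 3 g (ych i)‖ ≤ D₃ i)
    (h4 : ∀ i ∈ t, ∀ x ∈ voronoiCell (windowAtomSet Ach ych yunc) (ych i), ‖iteratedFDeriv ℝ 4 g x‖ ≤ D₄ i)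
    (e3 : ∀ j ∈ uref, ‖iteratedFDeriv ℝ 3 g (placedSite s ν q R j)‖ ≤ E₃ j)
    (e4 : ∀ j ∈ uref, ∀ x ∈ refCell s ν q R j, ‖iteratedFDeriv ℝ 4 g x‖ ≤ E₄ j) :
    |(∑ i ∈ t, (g (ych i) + ν ^ 2 / 16 / 2 * lap g (ych i)))
        - (∑ j ∈ uref, (g (placedSite s ν q R j) + ν ^ 2 / 16 / 2 * lap g (placedSite s ν q R j)))
        - (∑ i ∈ t, ((volume (voronoiCell (windowAtomSet Ach ych yunc) (ych i))).toReal⁻¹ - Real.sqrt 2 / ν ^ 3) *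
            ∫ x in voronoiCell (windowAtomSet Ach ych yunc) (ych i), g x)|
      ≤ (∑ i ∈ t, (a * (ν * (1 + σ) / Real.sqrt 2) * θv * D₁ i
          + (3 * |(ν * (1 - σ)) ^ 2 / 16| * θ * (1 + a) + 3 * |(ν * (1 - σ)) ^ 2 / 16| * θv
              + 3 * |(ν * (1 - σ)) ^ 2 / 16 - ν ^ 2 / 16| + (a * (ν * (1 + σ) / Real.sqrt 2)) ^ 2 * θv) / 2 * D₂ i
          + (idealTau (decide (s (i.1 - 1) = s i.1)) (ν * (1 - σ)) * a ^ 3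
              + (a * (ν * (1 + σ) / Real.sqrt 2)) ^ 3 * θv) / 6 * D₃ i
          + (41 / 960 * (ν * (1 - σ)) ^ 4 * a ^ 4 + (a * (ν * (1 + σ) / Real.sqrt 2)) ^ 4 * θv) / 24 * D₄ i))
        + (∑ j ∈ uref, (idealTau (decide (s (j.1 - 1) = s j.1)) ν / 6 * E₃ j + 41 / 960 * ν ^ 4 / 24 * E₄ j))
        + Real.sqrt 2 / ν ^ 3 * Bint := by
  obtain ⟨hd₁, hc₁, hcov₁, hci₁, hd₂, hc₂, hcov₂, hci₂⟩ := tiling_window hs hν hAfin hAne hinj ht hsep huref hgi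
  have hL := farField_ledger_of_shells hC hT hs hν q R Ach ych yunc hr₀ hû hreg q₀ hunc t uref (fun u hu => (ht u hu).1)
    hθ0 hm0 hm1 hσ0 hσ1 hθv0 hθv hδ₀ hθ hB ha hav hch hres1 hres2 hfar hρQ hal hsh2 hsh3 hlmin hl hr₁ hr₁' hin0 hout0
    hd₁ hc₁ hcov₁ hci₁ hd₂ hc₂ hcov₂ hci₂ hU hKU hKrU hg h1 h2 h3 h4 e3 e4
  rw [integral_moverRest_eq (halo_zero_act hs hν hr₀ hsupp (fun u hu1 hu2 => ⟨hchA u hu1 hu2, hreg u (hchA u hu1 hu2)⟩)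
      hz₀ hR₀ hh1 hh2), integral_refRest_eq (halo_zero_ref hs hν hr₀ hsupp hh)] at hL
  rw [abs_sub_comm] at hint
  exact abs_le_budget_of_seam (by positivity) hL hint

end

end Summit.AtomisticToContinuum.Crystallization.Theorems.OverbindingBudgetAffineFarFieldLedgerFinal
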